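import Summits.QuantumFields.BalabanUV.Beta.RowD1JointEndSymShift
import Summits.QuantumFields.BalabanUV.Beta.ReflectionLocusSymShift

/-!
# `BalabanUV.Beta.RowD1JointEndSymRefl` — binder row D1: THE LITERAL ROOT WITH THE FIRST-ORDER REFLECTION LETTER (Sr-conj) DISCHARGED —
# `RowD1JointEndSym.d1Drift_JsB12Sym_of_reflLetters_D1Tel_D1Rep : … → D1Drift Lc (JsB12Sym hLc N tabs cΛ cB) Nc μ ν` displaying, on the hR side, ONLY the
# tables' reflection letters (V-r)(V-ff0)(H-r), the shift's (Dff)(Dmm)(DG), and the second-order letter (Wr-conj-c)∕`hcomp` with the PINNED first-order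
# contact generator `γ j • diagK (ctGenM 3 (bhK Lc + Dsh) α Lc κ u)` (RULING R-D1-g28-2; E5 `ReflectionLocusSymShift.hSrC_JsB12Sym0`)

HONEST FRAMING (cell charter, verbatim): «discharging BetaPertH makes Balaban's UV stability UNCONDITIONAL — a real constructive-QFT result; it is
NOT the continuum limit and NOT the Clay problem.»  HONEST DEPENDENCY: continuum YM on T⁴ ⇐ BetaPertH ∧ nine spine estimates (0/9 proved); BetaPertH
⇐ (D1) ∧ (D4) ∧ CAP+tail; G-an2-4 gates asym, D1 and NE2/3/4.  DERIVED cell leaf (β sub-cell, BINDER-OWNERS row D1 OWNER `b2b-balaban-beta-an2`, gen 28).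
The namespace `RowD1JointEndSym` spans files (root at the 400-line cap; `…Literal` §7, `…Shift` §8–§9).  §10 = §9 (`d1Drift_JsB12Sym_of_shiftLetters_D1Tel_D1Rep`,
p255838) with its hypothesis hSrC (the (Sr-conj) letter of `(JsB12Sym0 …).S` at every level, generic contact family `C` with `LocStencil (C j α)`) DISCHARGED by
`ReflectionLocusSymShift.hSrC_JsB12Sym0` at the PINNED family `C j α κ u := γ j • diagK (ctGenM 3 (bhK Lc + Dsh) α Lc κ u)`, `γ j = −(Lc⁸∕2)·wVH 3 Lc j∕(stepScale 3 Lc j·Lc⁴)`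
(its `LocStencil` bound is a theorem: `E3ContactGenerator.locStencil_diagK_ctGenM` scaled).
WHAT §10 DISPLAYS (= the row's binder denominator at the literal after R-D1-g28-1∕-2; every one a hypothesis, none proved anywhere): the table record `tabs`; the
shift `Dsh` with (Dspr)(Dnull)(V-d) AND (Dff)(Dmm)(DG); the second-order Ward letter (Wd) with the pinned Ward generator, `X₂ʷ`, `Nr`; the tables' REFLECTION
letters (V-r) (three border leg pairs, every axis), (V-ff0), (H-r); the second-order reflection letter (Wr-conj-c) against `bhKStepSh 3 Lc Dsh j` with the PINNED
first-order contacts, `X₂`, compensator `Wc`; `hcomp` (pinned contacts); `D1Tel`; `D1Rep`; the printed B5 facts `h12`∕`h126`; the window; `γ` displayed with its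
defining equation.  HONEST COUNT: root-level classes {hW-letters = (V-d)(Dspr)(Dnull)(Wd), hR-letters = (V-r)(V-ff0)(H-r)(Dff)(Dmm)(DG)(Wr-conj-c), hcomp, D1Tel,
D1Rep}: 0∕5 discharged — BOTH first-order letters ((Sd) and (Sr-conj)) are now REDUCED to letters about an1's table VALUES and the displayed shift; table VALUES
0∕5 in tree; NOT D1, NOT `BetaPertH`, NOT continuum, NOT Clay.  No statement of Bałaban's papers, no `[cite:]`, no `Prop` fact, no `def`.
Provenance: β sub-cell, unit beta-an2 gen 28, 2026-08-21 (v1); over `RowD1JointEndSymShift` §9 and `ReflectionLocusSymShift` BY NAME; no existing file touched.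
-/

open Finset
open scoped BigOperators
open Literature.MathematicalPhysics.QuantumFieldTheory
open Literature.MathematicalPhysics.QuantumFieldTheory.Balaban1983to89
open Literature.MathematicalPhysics.QuantumFieldTheory.Balaban1983to89.Beta
open Literature.MathematicalPhysics.QuantumFieldTheory.Balaban1983to89.Beta.VectorTailsLoc (fam kfam)
open Literature.MathematicalPhysics.QuantumFieldTheory.Balaban1983to89.Beta.VectorLegVolumeAdapter (MvE)
open ExpKernelCalculus (MKer Decays BiLoc comp tr tadpole shiftK)
open AffineAveraging (box toSite)
open AveragingContoursRooted (ctr ctrOff ctrOff_mem_box)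
open PolarizationSign (reflSign WardTransversal AxisReflectionCovariant)
open KernelReflection (refK)
open ResolventReflection (bref Φ)
open OneStepResolventKernel (Fib LocStencil JetData)
open OneStepKernelFamily (KInvStep vertexOfK TbalOf flipK D1Tel D1Rep D1Drift)
open BalabanStepJetsSucc (wVH)
open Summit.QuantumFields.BalabanUV.Beta.TameKernelCalculus
open Summit.QuantumFields.BalabanUV.Beta.ChartConjugation (conjV conjW)
open Summit.QuantumFields.BalabanUV.Beta.ChartConjugationDefectEnd (conjDefect)
open Summit.QuantumFields.BalabanUV.Beta.AxialDressingRooted (one_le_of_neZero)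
open Summit.QuantumFields.BalabanUV.Beta.SymmetrisedDressingKernel (coDressKSymAt)
open Summit.QuantumFields.BalabanUV.Beta.SymmetrisedDressingDress (dressSymAt)
open Summit.QuantumFields.BalabanUV.Beta.AveragingWardRootedStencils (legInd)
open Summit.QuantumFields.BalabanUV.Beta.WardLocusStencils (ffK)
open Summit.QuantumFields.BalabanUV.Beta.SymmetrisedStepJets (SymTables Gsym JsB12Sym0 JsB12Sym)
open Summit.QuantumFields.BalabanUV.Beta.SymShiftedSpread (bhKStepSh)
open Summit.QuantumFields.BalabanUV.Beta.RelInvNullShift (spr_add)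
open Summit.QuantumFields.BalabanUV.Beta.E3ContactGenerator (ctGenM locStencil_diagK_ctGenM)
open Summit.QuantumFields.BalabanUV.Beta.ReflectionLocusSymShift (hSrC_JsB12Sym0)

namespace Summit.QuantumFields.BalabanUV.Beta.RowD1JointEndSym

noncomputable section

variable {Lc : ℕ} [NeZero Lc]

/-! ## §10 The literal root with (St)(Wt)(Sd) AND (Sr-conj) discharged; both first-order generators pinned -/

open B6BondElimination (unitVec) in
open KernelWard (divV divW) in
open Summit.QuantumFields.BalabanUV.Beta.BorderedHessian (sgnK bhK spr_bhK bhKStep stepScale diagK) in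
open Summit.QuantumFields.BalabanUV.Beta.SymSliceProjectorKernel (symEc) in
/-- [folklore] A scaled local stencil family of diagonal border-reading generators is a local stencil family. -/
theorem locStencil_smul_diagK_ctGenM {d : ℕ} {B : MKer (d + 1) (Fib d)} {C δ : ℝ} (hB : Decays B C δ) (hδ : 0 ≤ δ) (c : ℝ) (α : Fin (d + 1)) (L : ℕ) :
    LocStencil (fun κ u => c • diagK (ctGenM d B α L κ u)) (|c| * (1 + ((L : ℝ) ^ (d + 1))⁻¹ * C)) (δ / 2) := by
  intro κ u x y a b
  show |(c • diagK (ctGenM d B α L κ u)) x y a b| ≤ _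
  rw [Pi.smul_apply, Pi.smul_apply, Pi.smul_apply, Pi.smul_apply, smul_eq_mul, abs_mul, mul_assoc]
  exact mul_le_mul_of_nonneg_left (locStencil_diagK_ctGenM α L hB hδ κ u x y a b) (abs_nonneg c)

open B6BondElimination (unitVec) in
open KernelWard (divV divW) in
open Summit.QuantumFields.BalabanUV.Beta.BorderedHessian (sgnK bhK spr_bhK bhKStep stepScale diagK) in
open Summit.QuantumFields.BalabanUV.Beta.SymSliceProjectorKernel (symEc) in
/-- **ROW D1 — THE LITERAL ROOT AFTER RULINGS R-D1-g28-1 AND R-D1-g28-2**: `D1Drift Lc (JsB12Sym hLc N tabs cΛ cB) Nc μ ν` with BOTH first-order letters of the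
symmetrised literal REDUCED to table∕shift letters — (St)(Wt) by `SymmetrisedStepJets`, (Sd) by `WardLocusSymShift.hSd_JsB12Sym0` (R-D1-g28-1), **(Sr-conj) by
`ReflectionLocusSymShift.hSrC_JsB12Sym0`** (R-D1-g28-2), the first-order contact family PINNED to `γ j • diagK (ctGenM 3 (bhK Lc + Dsh) α Lc κ u)`,
`γ j = −(Lc⁸∕2)·wVH 3 Lc j∕(stepScale 3 Lc j·Lc⁴)`.  Displayed: `tabs`; `Dsh` with (Dspr)(Dnull)(V-d)(Dff)(Dmm)(DG); (Wd) with the pinned Ward generator, `X₂ʷ`, `Nr`; the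
tables' reflection letters (V-r)(V-ff0)(H-r); (Wr-conj-c) with the pinned contacts, `X₂`, `Wc`; `hcomp`; `D1Tel`; `D1Rep`; `h12`∕`h126`; the window.  HONEST: statement +
composition by name; 0∕5 root-level classes discharged (hW-letters = (V-d)(Dspr)(Dnull)(Wd); hR-letters = (V-r)(V-ff0)(H-r)(Dff)(Dmm)(DG)(Wr-conj-c)); tables 0∕5. -/
theorem d1Drift_JsB12Sym_of_reflLetters_D1Tel_D1Rep (hLc : Odd Lc) (hL2 : 2 ≤ Lc) (N : ℕ) (tabs : SymTables 3 Lc) (cΛ cB : ℝ)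
    -- the shift of R-D1-g28-1: (Dspr)(Dnull)(V-d), and R-D1-g28-2's (Dff)(Dmm)(DG)
    (Dsh : MKer 4 (Fib 3)) (hD : Spr Dsh) (hDnull : comp (comp (symEc Lc) Dsh) (symEc Lc) = 0)
    (hVd : ∀ u : Fin 4 → ℤ, conjV (bhK Lc + Dsh) (diagK (legInd (ctr 4 Lc) u)) =
      conjV (ffK (bhK (d := 3) Lc)) (diagK (legInd (ctr 4 Lc) u)) - ((Lc : ℝ) ^ 4) • divV tabs.V u)
    (hDff : ∀ (x z : Fin 4 → ℤ) (β β' : Fin 4), Dsh x z (Sum.inl β) (Sum.inl β') = 0)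
    (hDmm : ∀ (x y : Fin 4 → ℤ) (κ l : Fin 4), Dsh x y (Sum.inr κ) (Sum.inr l) = 0)
    (hGD : ∀ (j : ℕ) (x z : Fin 4 → ℤ) (m a : Fin 4), comp (Gsym (d := 3) Lc j) Dsh x z (Sum.inr m) (Sum.inl a) = 0)
    (hDG : ∀ (j : ℕ) (x z : Fin 4 → ℤ) (a m : Fin 4), comp Dsh (Gsym (d := 3) Lc j) x z (Sum.inl a) (Sum.inr m) = 0)
    -- hW: the second-order Ward letter with the PINNED Ward generator
    (X₂w Nr : ℕ → (Fin 4 → ℤ) → Fin 4 → (Fin 4 → ℤ) → MKer 4 (Fib 3)) (hX₂w : ∀ j y ν y', Loc (X₂w j y ν y'))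
    (hNr : ∀ j y ν y', Loc (Nr j y ν y')) (hEX₂w : ∀ j y ν y', comp (symEc Lc) (X₂w j y ν y') = comp (X₂w j y ν y') (symEc Lc))
    (hWd : ∀ (j : ℕ) (y : Fin 4 → ℤ) (ν : Fin 4) (y' : Fin 4 → ℤ),
      divW (JsB12Sym0 hLc N tabs cΛ cB j).W y ν y' =
        conjW (bhKStepSh 3 Lc Dsh j) 0 (vertexOfK (coDressKSymAt (toSite (ctrOff 4 Lc)) Lc (KInvStep (d := 3) Lc j)) Lc (JsB12Sym0 hLc N tabs cΛ cB j).S ν y')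
          (diagK ((1 / 2 : ℝ) • ∑ v ∈ box 4 Lc, legInd (ctr 4 Lc) ((Lc : ℤ) • y + toSite v))) 0 (X₂w j y ν y') + Nr j y ν y')
    (hNt : ∀ j y ν y', trK (Nr j y ν y') = -sgnK (Nr j y ν y'))
    -- hR, first order: the tables' REFLECTION letters (V-r)(V-ff0)(H-r)
    (hVfm : ∀ (α κ' : Fin 4) (u x z : Fin 4 → ℤ) (β m : Fin 4), tabs.V κ' (bref α κ' u) x z (Sum.inl β) (Sum.inr m) =
      (reflSign α κ' • refK (Φ (d := 3) Lc α) (tabs.V κ' u + conjV (bhK (d := 3) Lc + Dsh)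
        ((((Lc : ℝ) ^ 4)⁻¹) • diagK (ctGenM 3 (bhK Lc + Dsh) α Lc κ' u)))) x z (Sum.inl β) (Sum.inr m))
    (hVmf : ∀ (α κ' : Fin 4) (u x z : Fin 4 → ℤ) (m β : Fin 4), tabs.V κ' (bref α κ' u) x z (Sum.inr m) (Sum.inl β) =
      (reflSign α κ' • refK (Φ (d := 3) Lc α) (tabs.V κ' u + conjV (bhK (d := 3) Lc + Dsh)
        ((((Lc : ℝ) ^ 4)⁻¹) • diagK (ctGenM 3 (bhK Lc + Dsh) α Lc κ' u)))) x z (Sum.inr m) (Sum.inl β))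
    (hVmm : ∀ (α κ' : Fin 4) (u x z : Fin 4 → ℤ) (m m' : Fin 4), tabs.V κ' (bref α κ' u) x z (Sum.inr m) (Sum.inr m') =
      (reflSign α κ' • refK (Φ (d := 3) Lc α) (tabs.V κ' u + conjV (bhK (d := 3) Lc + Dsh)
        ((((Lc : ℝ) ^ 4)⁻¹) • diagK (ctGenM 3 (bhK Lc + Dsh) α Lc κ' u)))) x z (Sum.inr m) (Sum.inr m'))
    (hV0 : ∀ (κ : Fin 4) (w x z : Fin 4 → ℤ) (β β' : Fin 4), tabs.V κ w x z (Sum.inl β) (Sum.inl β') = 0)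
    (hHr : ∀ (α μ : Fin 4) (y : Fin 4 → ℤ), tabs.H μ (bref α μ y) = reflSign α μ • refK (Φ (d := 3) Lc α) (tabs.H μ y))
    -- the first-order contact coefficient, displayed
    (γ : ℕ → ℝ) (hγ : ∀ j, γ j = -((Lc : ℝ) ^ 8 / 2) * wVH 3 Lc j / (stepScale 3 Lc j * (Lc : ℝ) ^ 4))
    -- hR, second order, with the PINNED first-order contacts
    (X₂ Wc : ℕ → Fin 4 → Fin 4 → (Fin 4 → ℤ) → Fin 4 → (Fin 4 → ℤ) → MKer 4 (Fib 3))
    (hX₂ : ∀ j α μ y ν y', Loc (X₂ j α μ y ν y')) (hWc : ∀ j α μ y ν y', Loc (Wc j α μ y ν y'))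
    (hWrC : ∀ (j : ℕ) (α μ : Fin 4) (y : Fin 4 → ℤ) (ν : Fin 4) (y' : Fin 4 → ℤ),
      (JsB12Sym0 hLc N tabs cΛ cB j).W μ (bref α μ y) ν (bref α ν y') = (reflSign α μ * reflSign α ν) • refK (Φ Lc α) ((JsB12Sym0 hLc N tabs cΛ cB j).W μ y ν y' +
        conjW (bhKStepSh 3 Lc Dsh j) (vertexOfK (coDressKSymAt (toSite (ctrOff 4 Lc)) Lc (KInvStep (d := 3) Lc j)) Lc (JsB12Sym0 hLc N tabs cΛ cB j).S μ y)
          (vertexOfK (coDressKSymAt (toSite (ctrOff 4 Lc)) Lc (KInvStep (d := 3) Lc j)) Lc (JsB12Sym0 hLc N tabs cΛ cB j).S ν y')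
          (vertexOfK (coDressKSymAt (toSite (ctrOff 4 Lc)) Lc (KInvStep (d := 3) Lc j)) Lc (fun κ u => γ j • diagK (ctGenM 3 (bhK Lc + Dsh) α Lc κ u)) μ y)
          (vertexOfK (coDressKSymAt (toSite (ctrOff 4 Lc)) Lc (KInvStep (d := 3) Lc j)) Lc (fun κ u => γ j • diagK (ctGenM 3 (bhK Lc + Dsh) α Lc κ u)) ν y')
          (X₂ j α μ y ν y')
          + Wc j α μ y ν y'))
    (hcomp : ∀ (j : ℕ) (α μ : Fin 4) (y : Fin 4 → ℤ) (ν : Fin 4) (y' : Fin 4 → ℤ),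
      (1 / 2 : ℝ) * tadpole (coDressKSymAt (toSite (ctrOff 4 Lc)) Lc (KInvStep (d := 3) Lc j)) (Wc j α μ y ν y')
        + conjDefect (coDressKSymAt (toSite (ctrOff 4 Lc)) Lc (KInvStep (d := 3) Lc j)) (bhKStepSh 3 Lc Dsh j)
            (vertexOfK (coDressKSymAt (toSite (ctrOff 4 Lc)) Lc (KInvStep (d := 3) Lc j)) Lc (JsB12Sym0 hLc N tabs cΛ cB j).S μ y)
            (vertexOfK (coDressKSymAt (toSite (ctrOff 4 Lc)) Lc (KInvStep (d := 3) Lc j)) Lc (JsB12Sym0 hLc N tabs cΛ cB j).S ν y')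
            (vertexOfK (coDressKSymAt (toSite (ctrOff 4 Lc)) Lc (KInvStep (d := 3) Lc j)) Lc (fun κ u => γ j • diagK (ctGenM 3 (bhK Lc + Dsh) α Lc κ u)) μ y)
            (vertexOfK (coDressKSymAt (toSite (ctrOff 4 Lc)) Lc (KInvStep (d := 3) Lc j)) Lc (fun κ u => γ j • diagK (ctGenM 3 (bhK Lc + Dsh) α Lc κ u)) ν y')
            (X₂ j α μ y ν y') = 0)
    -- the route theorem's own binders, verbatim
    (a : ℝ) (ha : 0 < a)
    (h12 : B5.Prop12Printed (fam (fun i : ℕ+ × ℕ => ((i.1 : ℕ+) : ℕ)) (fun i => i.1.pos) MvE a ha))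
    (h126 : B5.Kernel126_127Printed (kfam (fun i : ℕ+ × ℕ => ((i.1 : ℕ+) : ℕ)) MvE))
    {L : Type*} {SL : Finset L} (hSL : SL.Nonempty) (k : L → Fin 4) {μ ν : Fin 4} (hμν : μ ≠ ν) {Nc : ℝ} (hNc : Nc ≠ 0)
    (Jc : ∀ m : ℕ, JetData 3 (Lc ^ m))
    (htel : D1Tel Lc (JsB12Sym hLc N tabs cΛ cB) Jc)
    {cc : ℝ} {Mw' : ℕ → ℕ} (hc : 1 ≤ cc) (hMwin : ∀ L : ℕ, 2 ≤ L → 1 ≤ Mw' L ∧ (L : ℝ) ≤ cc * Mw' L) (hML : ∀ L : ℕ, 2 ≤ L → Mw' L ≤ L)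
    (hrep : D1Rep Lc Jc Nc μ ν a SL k) :
    D1Drift Lc (JsB12Sym hLc N tabs cΛ cB) Nc μ ν := by
  obtain ⟨δB, CB, hδB, -, hBd⟩ := E3GenericReflection.Spr.decays' (spr_add (spr_bhK (d := 3) (one_le_of_neZero Lc)) hD)
  have hSrC : ∀ (j : ℕ) (α κ' : Fin 4) (u : Fin 4 → ℤ),
      (JsB12Sym0 hLc N tabs cΛ cB j).S κ' (bref α κ' u) =
        reflSign α κ' • refK (Φ Lc α) ((JsB12Sym0 hLc N tabs cΛ cB j).S κ' u +
          conjV (bhKStepSh 3 Lc Dsh j) (γ j • diagK (ctGenM 3 (bhK Lc + Dsh) α Lc κ' u))) := fun j α κ' u => by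
    rw [hγ]
    exact hSrC_JsB12Sym0 hLc N tabs cΛ cB hD hDnull hDff hDmm hGD hDG (hVfm α) (hVmf α) (hVmm α) hV0 hHr j κ' u
  exact d1Drift_JsB12Sym_of_shiftLetters_D1Tel_D1Rep hLc hL2 N tabs cΛ cB Dsh hD hDnull hVd X₂w Nr hX₂w hNr hEX₂w hWd hNt
    (fun j α κ u => γ j • diagK (ctGenM 3 (bhK Lc + Dsh) α Lc κ u)) (fun j => |γ j| * (1 + ((Lc : ℝ) ^ (3 + 1))⁻¹ * CB)) (fun _ => δB / 2)
    (fun j α => locStencil_smul_diagK_ctGenM hBd hδB.le (γ j) α Lc) (fun _ => half_pos hδB) X₂ Wc hX₂ hWc hSrC hWrC hcomp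
    a ha h12 h126 hSL k hμν hNc Jc htel hc hMwin hML hrep

end

end Summit.QuantumFields.BalabanUV.Beta.RowD1JointEndSym
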